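import Summits.BirchSwinnertonDyer.Rank1Residual.Additive.LocIrrOddPrimes
import Summits.BirchSwinnertonDyer.Rank1Residual.Additive.RamifiedOrdinaryLineExponent
import Summits.BirchSwinnertonDyer.Rank1Residual.AdditivePotMult.RamifiedOrdinaryLinePotMult
import HarnessLib

/-!
# `E[p]|G_{ℚ_p}` is REDUCIBLE as soon as a decomposition group stabilises a line of `E[p](ℚ̄)`:
# `¬ LocIrr` on every potentially ORDINARY / potentially MULTIPLICATIVE additive row and at every
# good ORDINARY prime; the dichotomy `LocIrr W p ↔ p ∣ a_p` at odd good `p`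
# (cell `b2b-bsdres`, team n1011, prover p05 GEN 14, row T-LRED)

HONEST FRAMING (cell `b2b-bsdres`, run/shared/lean/b2b/bsd-rank1-residual/, verbatim in every
file): the goal of the cell is to DELETE the COMBINATION-SHAPED residual classes of the
Birch–Swinnerton-Dyer formula for ALL analytic-rank `≤ 1` elliptic curves over `ℚ` — "full BSD
formula for every rank `≤ 1` curve in class `C`" assembled STRICTLY from published theorems — so
that the rank-`≤ 1` remainder becomes exactly the CONSTRUCTION-SHAPED classes, which are TYPED
(missing-input `Prop`s), NOT attempted. This is not "finishing BSD". Research route; no claim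
beyond the stated classes; nothing is booked here; no mark of `RESIDUAL-MAP.md` moves. THEOREMS
ONLY (no definition, no named fact, no conjecture node; net named-fact debt `0`). TOOL theorems
close nothing beyond themselves.

## What this file does

The census decides the Fouquet–Wan `(Lgl)` bit `LocIrr W p` (`Additive/FouquetWanLocus.lean`:
`E[p]` irreducible as a `Gal(ℚ̄_p/ℚ_p)`-module) and carries the sentence "the potentially ORDINARY
half 'pot-ord ⟹ LocRed' is correct as printed and is the N10 axis, `TypeGOrd`, not restated here"
(`Additive/LocIrrValuationCriterionTame.lean`, module docstring). Here that half — and its good-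
ordinary and potentially-multiplicative siblings — become kernel theorems, all through ONE tool:

* §1 **`not_locIrr_of_stable_line`** — for `W/ℚ` elliptic, a prime `p`, a finite place `v ∋ p` and
  ANY subgroup `Φ ≤ E[p](ℚ̄)` of order `p` stable under the decomposition group
  `decomp v = res(Γ_{ℚ_v})` of the tree's `GreenbergSelmer` (the currency of every Greenberg
  `LocalDatum` of the cell): `¬ LocIrr W p`. Transport: the prime `𝔓₁ ∣ v` of `\bar ℤ` cut out by
  `ℚ̄ → \bar ℚ_v` has `D_{𝔓₁} = res Γ_{ℚ_v}` (`decompositionSubgroup_adicCompletionPrime_eq_range`),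
  the prime `𝔓₀` cut out by `ℚ̄ → ℚ̄_p = \overline{ℚ_[p]}` has `D_{𝔓₀} = res Γ_{ℚ_p}`
  (`decompositionSubgroup_eq_range_absGaloisRestrict`, as in harvest-2's
  `LocIrrOfGoodSupersingular`); `Γ_ℚ` is transitive on the primes above `v`
  (`exists_smul_eq_of_mem_primesAbove_holds`, Neukirch I (9.1)) and `D_{g𝔓₀} ∋ g δ g⁻¹` for
  `δ ∈ D_{𝔓₀}`, so `g⁻¹Φ` is `res Γ_{ℚ_p}`-stable; the `res`-equivariant torsion transfer
  `E[p](ℚ̄) ≃+ (W⁄ℚ_p)[p](ℚ̄_p)` (`torsionTransferEquiv`) then yields a `Γ_{ℚ_p}`-stable subgroup of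
  order `p`, and harvest-2's `not_locIrr_of_exists_stable_addSubgroup` concludes.
* §2 **`not_locIrr_of_localDatum_of_natCard`** — every `LocalDatum ℚ E[p^∞] v` whose line meets
  `E[p^∞][p]` in `p` elements gives `¬ LocIrr W p`; in particular
  **`not_locIrr_of_isRamifiedOrdinaryLine`** (the pot-mult lane's `natCard_plus_inf_torsionBy_eq`).
* §3 **`not_locIrr_of_typeGOrd`** — `p` odd, `Addv W p`, `TypeGOrd W p` ⟹ `¬ LocIrr W p`: the
  N10 axis is provably on the LocRed side at EVERY odd `p` (lines from p05 F-C2 / p10 / the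
  `e = 2` file, by name: `exists_isRamifiedOrdinaryLine_and_pow_semistabilityIndex_of_typeGOrd`,
  `RamifiedOrdinaryLineExponentTwo.exists_isRamifiedOrdinaryLine_and_sq_of_typeGOrd`); class forms
  `ClassX4Gord.not_locIrr`, `ClassX3Gord.not_locIrr`; contrapositive `not_typeGOrd_of_locIrr`.
* §4 **`not_locIrr_of_goodOrd`** (EVERY prime `p`; X2's `reductionDatum` with
  `natCard_reductionDatum_plus_inf_torsionBy`) and, with harvest-2's Serre Prop. 12
  (`locIrr_of_dvd_frobeniusTrace`), the DICHOTOMY **`locIrr_iff_dvd_frobeniusTrace_of_good`**: at an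
  odd prime of good reduction `LocIrr W p ↔ p ∣ a_p(W)` (the tree had `p = 3`:
  `locIrr_three_iff_dvd_frobeniusTrace_of_hasGoodReductionAtPrime`, and the `⇐`/contrapositive
  `goodOrd_of_not_locIrr` at all odd `p`).
* §5 **`not_locIrr_of_potMult`** — additive potentially multiplicative, `p` odd, granted the Tate
  uniformisation facts A40/A41 exactly as the pot-mult lane's `PotMult.exists_isRamifiedOrdinaryLine`
  (which supplies the line); `ClassX4M.not_locIrr`; contrapositive `not_potMult_of_locIrr`.

So on the odd additive locus a `LocIrr` row is potentially SUPERSINGULAR (neither `TypeGOrd` nor,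
mod A40/A41, `PotMult`) — the census's partition sentence as a theorem. Nothing booked; no mark
moves; no class closes (this is the hypothesis bit of Fouquet–Wan, not a `p`-part statement).

References: J.-P. Serre, *Propriétés galoisiennes des points d'ordre fini des courbes elliptiques*,
Invent. Math. 15 (1972), §1.11 Prop. 11–12 [Serre1972]; R. Greenberg, *Iwasawa theory for
`p`-adic representations*, Adv. Stud. Pure Math. 17 (1989), §1 p. 98 (1)(b) ("`F⁺V_p` is invariant
for the action of `G_{ℚ_p}`") [Greenberg1989]; J. Neukirch, *Algebraic Number Theory* (1999), Ch. I
§9 (9.1), Ch. II §9 (9.6) [NeukirchANT1999]; M. Emerton, R. Pollack, T. Weston, Invent. Math. 163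
(2006) §3.1 [EmertonPollackWeston2006].
-/

set_option autoImplicit false

noncomputable section

open scoped Classical NumberField Pointwise AddSubgroup

open WeierstrassCurve Literature.NumberTheory.EllipticCurves
  Literature.NumberTheory.EllipticCurves.Rank1Residual
  Literature.NumberTheory.EllipticCurves.GreenbergSelmer
  Literature.NumberTheory.EllipticCurves.EmertonPollackWeston2006
  Literature.NumberTheory.GaloisRepresentations Field IsDedekindDomain NumberField
  Rat.HeightOneSpectrum

namespace Summit.BirchSwinnertonDyer.Rank1Residual.Additive

/-! ## §1 The tool: a decomposition-stable line of `E[p](ℚ̄)` makes `E[p]|G_{ℚ_p}` reducible -/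

section Tool

variable (W : WeierstrassCurve ℚ) [W.IsElliptic] (p : ℕ) [hp : Fact p.Prime]
  {v : HeightOneSpectrum (𝓞 ℚ)}

/-- **A `D_v`-stable line of `E[p](ℚ̄)` at a place `v ∋ p` makes `E[p]|G_{ℚ_p}` REDUCIBLE.** For
`W/ℚ` elliptic, `p` prime, `v ∋ p`, and a subgroup `Φ ≤ E[p](ℚ̄)` of order `p` stable under
`res σ` for every `σ ∈ Γ_{ℚ_v}` (the decomposition group `decomp v` of the tree's `GreenbergSelmer`):
`¬ LocIrr W p`. The primes of `\bar ℤ` above `v` cut out by `ℚ̄ → \bar ℚ_v` and by `ℚ̄ → ℚ̄_p`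
are conjugate under `Γ_ℚ` (Neukirch I (9.1)), their decomposition groups are `res Γ_{ℚ_v}` and
`res Γ_{ℚ_p}` (Neukirch II (9.6)), so a conjugate of `Φ` is `res Γ_{ℚ_p}`-stable and is carried by
the equivariant torsion transfer to a `Γ_{ℚ_p}`-stable subgroup of order `p` of `(W⁄ℚ_p)[p](ℚ̄_p)`.
[cite: NeukirchANT1999, Ch. I §9 Prop. (9.1) and Ch. II §9 Prop. (9.6)] [cite: Greenberg1989, §1 p. 98 (1)(b)] -/
theorem not_locIrr_of_stable_line (hpv : ((p : ℕ) : 𝓞 ℚ) ∈ v.asIdeal)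
    {Φ : AddSubgroup (geomTorsion W (p : ℤ))} (hΦ : Nat.card Φ = p)
    (hstab : ∀ (σ : absoluteGaloisGroup (v.adicCompletion ℚ)), ∀ P ∈ Φ,
      absGaloisRestrict ℚ (v.adicCompletion ℚ) σ • P ∈ Φ) :
    ¬ LocIrr W p := by
  have hpp : p.Prime := hp.out
  have hv : (primesEquiv v : ℕ) = p := primesEquiv_eq_of_natCast_mem v hpp hpv
  -- the prime `𝔓₁ ∣ v` cut out by `ℚ̄ → \bar ℚ_v`: `D_{𝔓₁} = res Γ_{ℚ_v}`
  have h𝔓₁ : adicCompletionPrime ℚ v ∈ v.primesAbove := adicCompletionPrime_mem_primesAbove ℚ v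
  have hD₁ := decompositionSubgroup_adicCompletionPrime_eq_range (K := ℚ) (v := v)
  -- the prime `𝔓₀ ∣ v` cut out by `ℚ̄ → ℚ̄_p`: `D_{𝔓₀} = res Γ_{ℚ_p}`
  have hO := X11b.PadicInertiaCharacter.norm_algebraMap_ringOfIntegers_le_one p
  obtain ⟨𝔓₀, h𝔓₀⟩ := exists_ideal_forall_mem_iff_spectralNorm_lt_one ℚ ℚ_[p] hO
  have h𝔓₀v : 𝔓₀ ∈ v.primesAbove :=
    mem_primesAbove_of_forall_mem_iff v
      (X11b.PadicInertiaCharacter.norm_algebraMap_ringOfIntegers_lt_one_iff p v hv) 𝔓₀ h𝔓₀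
  have hD₀ : 𝔓₀.decompositionSubgroup (absoluteGaloisGroup ℚ) =
      (absGaloisRestrict ℚ ℚ_[p]).toMonoidHom.range :=
    decompositionSubgroup_eq_range_absGaloisRestrict
      (X11b.PadicInertiaCharacter.denseRange_algebraMap p) hO
      (X11b.PadicInertiaCharacter.exists_norm_algebraMap_lt_one p) 𝔓₀ h𝔓₀
  -- the two primes are conjugate: `g • 𝔓₀ = 𝔓₁`
  obtain ⟨g, hg⟩ :=
    HeightOneSpectrum.exists_smul_eq_of_mem_primesAbove_holds (K := ℚ) (v := v) h𝔓₀v h𝔓₁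
  -- `Φ₀ = g⁻¹ Φ = {P | g • P ∈ Φ}`
  let Φ₀ : AddSubgroup (geomTorsion W (p : ℤ)) :=
    Φ.comap (DistribSMul.toAddMonoidHom (geomTorsion W (p : ℤ)) g)
  have hmemΦ₀ : ∀ P, P ∈ Φ₀ ↔ g • P ∈ Φ := fun P ↦ Iff.rfl
  have hΦ₀ : Nat.card Φ₀ = p :=
    (Nat.card_congr
      { toFun := fun P ↦ ⟨g • P.1, (hmemΦ₀ P.1).mp P.2⟩
        invFun := fun Q ↦ ⟨g⁻¹ • Q.1, by rw [hmemΦ₀, smul_inv_smul]; exact Q.2⟩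
        left_inv := fun P ↦ Subtype.ext (inv_smul_smul g P.1)
        right_inv := fun Q ↦ Subtype.ext (smul_inv_smul g Q.1) : Φ₀ ≃ Φ }).trans hΦ
  -- `Φ₀` is stable under `D_{𝔓₀}`: for `δ ∈ D_{𝔓₀}`, `g δ g⁻¹ ∈ D_{g • 𝔓₀} = D_{𝔓₁} = res Γ_{ℚ_v}`
  have hstab₀ : ∀ δ ∈ 𝔓₀.decompositionSubgroup (absoluteGaloisGroup ℚ), ∀ P ∈ Φ₀, δ • P ∈ Φ₀ := by
    intro δ hδ P hP
    rw [hmemΦ₀] at hP ⊢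
    have hconj : MulAut.conj g • δ ∈
        (adicCompletionPrime ℚ v).decompositionSubgroup (absoluteGaloisGroup ℚ) := by
      rw [← hg, Ideal.decompositionSubgroup_smul]
      exact Subgroup.smul_mem_pointwise_smul _ _ _ hδ
    rw [hD₁] at hconj
    obtain ⟨σ, hσ⟩ := MonoidHom.mem_range.mp hconj
    have h := hstab σ _ hP
    rw [show absGaloisRestrict ℚ (v.adicCompletion ℚ) σ = g * δ * g⁻¹ from
        hσ.trans (MulAut.conj_apply g δ), mul_smul, mul_smul, inv_smul_smul] at h
    exact h
  -- hence under `res Γ_{ℚ_p}`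
  have hstab₀' : ∀ (σ : absoluteGaloisGroup ℚ_[p]), ∀ P ∈ Φ₀,
      absGaloisRestrict ℚ ℚ_[p] σ • P ∈ Φ₀ :=
    fun σ P hP ↦ hstab₀ _ (hD₀ ▸ MonoidHom.mem_range.mpr ⟨σ, rfl⟩) P hP
  -- transfer to `(W⁄ℚ_p)[p](ℚ̄_p)`
  have hp0 : (p : ℤ) ≠ 0 := by exact_mod_cast hpp.ne_zero
  let t := W.torsionTransferEquiv (E := ℚ_[p]) hp0
  let H : AddSubgroup (geomTorsion (W.baseChange ℚ_[p]) (p : ℤ)) := Φ₀.map t.toAddMonoidHom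
  refine not_locIrr_of_exists_stable_addSubgroup W p ⟨H, ?_, ?_⟩
  · intro σ Q hQ
    obtain ⟨P, hP, rfl⟩ := AddSubgroup.mem_map.mp hQ
    refine AddSubgroup.mem_map.mpr ⟨absGaloisRestrict ℚ ℚ_[p] σ • P, hstab₀' σ P hP, ?_⟩
    exact W.torsionTransferEquiv_smul (E := ℚ_[p]) hp0 σ P
  · exact (Nat.card_congr (Φ₀.equivMapOfInjective t.toAddMonoidHom t.injective).toEquiv).symm.trans
      hΦ₀

end Tool

/-! ## §2 Greenberg local data with a line meeting `E[p^∞][p]` in `p` elements; ramified ordinary lines -/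

section Datum

variable (W : WeierstrassCurve ℚ) [W.IsElliptic] (p : ℕ) [hp : Fact p.Prime]
  {v : HeightOneSpectrum (𝓞 ℚ)}

/-- **A Greenberg local datum whose line meets `E[p^∞][p]` in `p` elements makes `E[p]|G_{ℚ_p}`
reducible.** For `L : LocalDatum ℚ E[p^∞] v` (`v ∋ p`; `L.plus` stable under `res Γ_{ℚ_v}` by
definition — Greenberg 1989 (1)(b)) with `#(L.plus ⊓ E[p^∞][p]) = p`: `¬ LocIrr W p`. The
intersection, read inside `E[p](ℚ̄) ≤ E[p^∞](ℚ̄)`, is the `D_v`-stable line of §1.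
[cite: Greenberg1989, §1 p. 98 (1)(b), (4)] -/
theorem not_locIrr_of_localDatum_of_natCard (hpv : ((p : ℕ) : 𝓞 ℚ) ∈ v.asIdeal)
    (L : LocalDatum ℚ (W.geomPrimaryTorsion p) v)
    (hcard : Nat.card ↥(L.plus ⊓ (↥(W.geomPrimaryTorsion p))[(p : ℤ)]) = p) : ¬ LocIrr W p := by
  -- the inclusion `E[p] ↪ E[p^∞]` and `Φ = ι⁻¹(L.plus)`
  let ι : geomTorsion W (p : ℤ) →+ W.geomPrimaryTorsion p :=
    AddSubgroup.inclusion (geomTorsion_le_geomPrimaryTorsion W p)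
  let Φ : AddSubgroup (geomTorsion W (p : ℤ)) := L.plus.comap ι
  have hmemΦ : ∀ P, P ∈ Φ ↔ ι P ∈ L.plus := fun P ↦ Iff.rfl
  have hιtor : ∀ P : geomTorsion W (p : ℤ), ι P ∈ (↥(W.geomPrimaryTorsion p))[(p : ℤ)] := fun P ↦
    AddSubgroup.torsionBy.nsmul_iff.mpr (by rw [← map_nsmul, AddSubgroup.torsionBy.nsmul, map_zero])
  refine not_locIrr_of_stable_line W p hpv (Φ := Φ) ?_ ?_
  · -- `#Φ = #(L.plus ⊓ E[p^∞][p]) = p`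
    refine Eq.trans (Nat.card_congr ?_) hcard
    -- the `p`-torsion point underlying an element of `L.plus ⊓ E[p^∞][p]`
    have htor : ∀ m : ↥(L.plus ⊓ (↥(W.geomPrimaryTorsion p))[(p : ℤ)]),
        ((m.1 : W.geomPrimaryTorsion p) : W.geomPoints) ∈ geomTorsion W (p : ℤ) := fun m ↦
      AddSubgroup.torsionBy.nsmul_iff.mpr (by
        have h := AddSubgroup.torsionBy.nsmul_iff.mp (AddSubgroup.mem_inf.mp m.2).2
        rw [← AddSubmonoidClass.coe_nsmul, h, ZeroMemClass.coe_zero])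
    have hι : ∀ m : ↥(L.plus ⊓ (↥(W.geomPrimaryTorsion p))[(p : ℤ)]),
        ι ⟨((m.1 : W.geomPrimaryTorsion p) : W.geomPoints), htor m⟩ = m.1 := fun m ↦ Subtype.ext rfl
    exact
      { toFun := fun P ↦ ⟨ι P.1, AddSubgroup.mem_inf.mpr ⟨(hmemΦ P.1).mp P.2, hιtor P.1⟩⟩
        invFun := fun m ↦ ⟨⟨((m.1 : W.geomPrimaryTorsion p) : W.geomPoints), htor m⟩, by
          rw [hmemΦ, hι]; exact (AddSubgroup.mem_inf.mp m.2).1⟩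
        left_inv := fun P ↦ Subtype.ext (Subtype.ext rfl)
        right_inv := fun m ↦ Subtype.ext (hι m) }
  · -- `Φ` is `res Γ_{ℚ_v}`-stable because `L.plus` is
    intro σ P hP
    rw [hmemΦ] at hP ⊢
    exact L.smul_mem σ hP

/-- **A ramified ordinary line makes `E[p]|G_{ℚ_p}` reducible**: `IsRamifiedOrdinaryLine W p L` at
`v ∋ p` ⟹ `¬ LocIrr W p` (the line meets `E[p^∞][p]` in exactly `p` elements:
`RamifiedLineUnique.natCard_plus_inf_torsionBy_eq`). EPW §3.1's `A'_{f,i}` is a `G_p`-submodule.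
[cite: EmertonPollackWeston2006, §3.1 (eq:ordes) (arXiv:math/0404484 p. 17)] -/
theorem not_locIrr_of_isRamifiedOrdinaryLine (hpv : ((p : ℕ) : 𝓞 ℚ) ∈ v.asIdeal)
    {L : LocalDatum ℚ (W.geomPrimaryTorsion p) v} (hL : IsRamifiedOrdinaryLine W p L) :
    ¬ LocIrr W p :=
  not_locIrr_of_localDatum_of_natCard W p hpv L
    (AdditivePotMult.RamifiedLineUnique.natCard_plus_inf_torsionBy_eq hL)

omit hp in
/-- A finite place of `ℚ` above the prime `p` exists (the maximal ideal of `𝓞 ℚ ≅ ℤ` containing `p`).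
[folklore] -/
private theorem exists_natCast_mem_asIdeal (hpp : p.Prime) :
    ∃ v : HeightOneSpectrum (𝓞 ℚ), ((p : ℕ) : 𝓞 ℚ) ∈ v.asIdeal := by
  have hnu : ¬ IsUnit ((p : ℕ) : 𝓞 ℚ) := by
    intro hu
    have h := hu.map Rat.ringOfIntegersEquiv
    rw [map_natCast, Int.isUnit_iff] at h
    have h1 := hpp.one_lt
    rcases h with h | h <;> omega
  obtain ⟨M, hM, hpM⟩ := Ideal.exists_le_maximal (Ideal.span {((p : ℕ) : 𝓞 ℚ)})
    (Ideal.span_singleton_ne_top hnu)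
  have hpM' : ((p : ℕ) : 𝓞 ℚ) ∈ M := hpM (Ideal.mem_span_singleton_self _)
  refine ⟨⟨M, hM.isPrime, fun hbot ↦ ?_⟩, hpM'⟩
  rw [hbot, Ideal.mem_bot] at hpM'
  exact hpp.ne_zero (by exact_mod_cast hpM')

end Datum

/-! ## §3 The N10 axis: potentially good ORDINARY additive rows are LocRed at every odd `p` -/

section Gord

variable (W : WeierstrassCurve ℚ) [W.IsElliptic] [W.IsGloballyMinimal] (p : ℕ) [hp : Fact p.Prime]

/-- **pot-ord ⟹ LocRed (the census's sentence, as a theorem): `p` odd, `W` additive at `p` of type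
(G)-ordinary ⟹ `E[p]|G_{ℚ_p}` is REDUCIBLE.** The ramified ordinary line exists on every such row
(`p ≥ 5`: `exists_isRamifiedOrdinaryLine_and_pow_semistabilityIndex_of_typeGOrd`, every defect
`e ∈ {2,3,4,6}`; `p = 3`: `e = 2` is forced, `semistabilityIndex_eq_two_of_typeG_three`, and the
`e = 2` line is `RamifiedOrdinaryLineExponentTwo.exists_isRamifiedOrdinaryLine_and_sq_of_typeGOrd`)
and is `D_v`-stable. [cite: Serre1972, §1.11 Prop. 11] [cite: EmertonPollackWeston2006, §3.1 (eq:ordes) (arXiv:math/0404484 p. 17)] -/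
theorem not_locIrr_of_typeGOrd (hp2 : p ≠ 2) (hG : TypeGOrd W p) (hadd : Addv W p) :
    ¬ LocIrr W p := by
  obtain ⟨v, hpv⟩ := exists_natCast_mem_asIdeal p hp.out
  rcases Nat.lt_or_ge p 5 with hlt | hp5
  · have hp3 : p = 3 := by
      have h2 := hp.out.two_le
      interval_cases p
      · exact absurd rfl hp2
      · rfl
      · exact absurd hp.out (by decide)
    subst hp3
    obtain ⟨L, hL, -⟩ :=
      RamifiedOrdinaryLineExponentTwo.exists_isRamifiedOrdinaryLine_and_sq_of_typeGOrd hp2 hG hadd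
        (semistabilityIndex_eq_two_of_typeG_three W hG.typeG hadd) hpv
    exact not_locIrr_of_isRamifiedOrdinaryLine W 3 hpv hL
  · obtain ⟨L, hL, -⟩ :=
      exists_isRamifiedOrdinaryLine_and_pow_semistabilityIndex_of_typeGOrd hp5 hG hadd hpv
    exact not_locIrr_of_isRamifiedOrdinaryLine W p hpv hL

/-- Contrapositive for the census columns: an additive `LocIrr` row at an odd `p` is NOT of type
(G)-ordinary — it lies on the potentially supersingular / potentially multiplicative side.
[cite: Serre1972, §1.11 Prop. 11] -/
theorem not_typeGOrd_of_locIrr (hp2 : p ≠ 2) (hadd : Addv W p) (hL : LocIrr W p) : ¬ TypeGOrd W p :=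
  fun hG ↦ not_locIrr_of_typeGOrd W p hp2 hG hadd hL

variable {W p}

/-- **X4♯(G-ord) rows are LocRed** (every odd `p`). X4♯(G-ord) stays CONSTRUCTION-SHAPED; nothing
booked. [cite: EmertonPollackWeston2006, §3.1 (eq:ordes) (arXiv:math/0404484 p. 17)] -/
theorem ClassX4Gord.not_locIrr (hX : ClassX4Gord W p) : ¬ LocIrr W p :=
  not_locIrr_of_typeGOrd W p hX.addv.1 hX.typeGOrd hX.addv.2

omit [W.IsGloballyMinimal] in
/-- **X3♯(G-ord) rows are LocRed** (any `p`; here already because `E[p]` is globally reducible,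
`not_locIrr_of_red`) — stated next to its X4 twin for the census reader. [folklore] -/
theorem ClassX3Gord.not_locIrr (hX : ClassX3Gord W p) : ¬ LocIrr W p :=
  not_locIrr_of_red W p hX.classX3.1

end Gord

/-! ## §4 Good ORDINARY primes are LocRed (every `p`); the dichotomy at odd good `p` -/

section Good

variable (W : WeierstrassCurve ℚ) [W.IsElliptic] [W.IsGloballyMinimal] (p : ℕ) [hp : Fact p.Prime]

/-- **Good ordinary ⟹ LocRed, at EVERY prime `p`**: `p ∤ Δ_min(W)`, `p ∤ a_p(W)` ⟹ `E[p]|G_{ℚ_p}`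
reducible — Greenberg's datum `C_v = ker(E[p^∞] → Ẽ(k̄_v))` (X2's `reductionDatum`, `D_v`-stable
because reduction commutes with `Γ_{ℚ_v}`) meets `E[p^∞][p]` in `p` elements at an ordinary prime
(`natCard_reductionDatum_plus_inf_torsionBy`: the kernel of reduction on `E[p]` is the line `Ê[p]`).
[cite: Serre1972, §1.11 Prop. 11] [cite: GreenbergLNM1716, §1 p. 62 and §2 p. 70] -/
theorem not_locIrr_of_goodOrd (hΔ : ¬ (p : ℤ) ∣ minimalDiscriminantInt W)
    (hord : ¬ (p : ℤ) ∣ W.frobeniusTrace p) : ¬ LocIrr W p := by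
  obtain ⟨v, hpv⟩ := exists_natCast_mem_asIdeal p hp.out
  exact not_locIrr_of_localDatum_of_natCard W p hpv
    (X2.GreenbergVatsalReductionDatum.reductionDatum W p hpv hΔ)
    (X2.GreenbergVatsalReductionDatum.natCard_reductionDatum_plus_inf_torsionBy W p hpv hΔ hord)

/-- `GoodOrd W p ⟹ ¬ LocIrr W p` (the census atom). [cite: Serre1972, §1.11 Prop. 11] -/
theorem not_locIrr_of_goodOrd' (h : GoodOrd W p) : ¬ LocIrr W p :=
  not_locIrr_of_goodOrd W p (W.not_dvd_minimalDiscriminantInt_of_hasGoodReductionAtPrime' p h.1) h.2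

/-- **THE DICHOTOMY at an odd prime of good reduction: `E[p]|G_{ℚ_p}` is irreducible iff the
reduction is SUPERSINGULAR** (`LocIrr W p ↔ p ∣ a_p(W)`): `⇐` is Serre's Prop. 12 (harvest-2's
`locIrr_of_dvd_frobeniusTrace`), `⇒` is Prop. 11 (`not_locIrr_of_goodOrd`). The tree had the `p = 3`
instance (`locIrr_three_iff_dvd_frobeniusTrace_of_hasGoodReductionAtPrime`, via `Ψ₃`).
[cite: Serre1972, §1.11 Prop. 11 and Prop. 12] -/
theorem locIrr_iff_dvd_frobeniusTrace_of_good (hp2 : p ≠ 2) (hgood : W.HasGoodReductionAtPrime p) :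
    LocIrr W p ↔ (p : ℤ) ∣ W.frobeniusTrace p :=
  ⟨fun hL ↦ by_contra fun hord ↦
    not_locIrr_of_goodOrd W p (W.not_dvd_minimalDiscriminantInt_of_hasGoodReductionAtPrime' p hgood)
      hord hL,
    fun hss ↦ locIrr_of_dvd_frobeniusTrace W p hp2 hgood hss⟩

end Good

/-! ## §5 Potentially MULTIPLICATIVE additive rows are LocRed (odd `p`, mod A40/A41) -/

section PotMult

variable (W : WeierstrassCurve ℚ) [W.IsElliptic] (p : ℕ) [hp : Fact p.Prime]

/-- **pot-mult ⟹ LocRed** (`p` odd; granted the Tate uniformisation facts A40/A41 exactly as the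
pot-mult lane's `PotMult.exists_isRamifiedOrdinaryLine`, which supplies the `D_v`-stable line: the
`μ_{p^∞}`-line of the Tate curve, twisted by the ramified quadratic character).
[cite: SilvermanATAEC1994, Ch. V Thm. 5.3, Cor. 5.4] [cite: Serre1972, §1.11 (the Tate curve case)] -/
theorem not_locIrr_of_potMult (hT40 : Silverman1994_thmV53_tateUniformisation.{0})
    (hT41 : Silverman1994_thmV53_corV54_tateUniformisation.{0}) (hp2 : p ≠ 2)
    (hpm : AdditivePotMult.PotMult W p) : ¬ LocIrr W p := by
  obtain ⟨v, hpv⟩ := exists_natCast_mem_asIdeal p hp.out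
  obtain ⟨L, hL⟩ := hpm.exists_isRamifiedOrdinaryLine hT40 hT41 hp2 hpv
  exact not_locIrr_of_isRamifiedOrdinaryLine W p hpv hL

/-- Contrapositive: an additive `LocIrr` row at an odd `p` is NOT potentially multiplicative
(mod A40/A41). [cite: SilvermanATAEC1994, Ch. V Thm. 5.3, Cor. 5.4] -/
theorem not_potMult_of_locIrr (hT40 : Silverman1994_thmV53_tateUniformisation.{0})
    (hT41 : Silverman1994_thmV53_corV54_tateUniformisation.{0}) (hp2 : p ≠ 2) (hL : LocIrr W p) :
    ¬ AdditivePotMult.PotMult W p :=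
  fun hpm ↦ not_locIrr_of_potMult W p hT40 hT41 hp2 hpm hL

variable {W p}

/-- **X4(M) rows are LocRed** (every odd `p`, mod A40/A41). X4(M) stays CONSTRUCTION-SHAPED;
nothing booked. [cite: SilvermanATAEC1994, Ch. V Thm. 5.3, Cor. 5.4] -/
theorem ClassX4M.not_locIrr (hT40 : Silverman1994_thmV53_tateUniformisation.{0})
    (hT41 : Silverman1994_thmV53_corV54_tateUniformisation.{0}) (hX : AdditivePotMult.ClassX4M W p) :
    ¬ LocIrr W p := by
  obtain ⟨v, hpv⟩ := exists_natCast_mem_asIdeal p hp.out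
  obtain ⟨L, hL⟩ := hX.exists_isRamifiedOrdinaryLine hT40 hT41 hpv
  exact not_locIrr_of_isRamifiedOrdinaryLine W p hpv hL

end PotMult

end Summit.BirchSwinnertonDyer.Rank1Residual.Additive

end
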